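import Mathlib
import HarnessLib
import Summits.NavierStokesRegularity.NavierStokesRegularity.Theorems.PoloidalWindowDoorPoloidalWindowRigidityConstantShearVariance

/-!
# Route `PoloidalWindowDoor`, crux `PoloidalWindowRigidity` (K2, stmt-NavierStokesRegularity-19708) —
# the CONSTANT-SHEAR («wave») stratum: the differential inequality for the weighted horizontal variance

Cell ns-regularity-ideate, seat ns-poloidal-K2-p2 (stub-worker, gen 2; support lemmas `--supports` the crux,
`--as helper`).  Fifth brick of the (M)-consuming exclusion of `∂₂v_h ≡ μ∇_h v₂` (`μ < 1` constant).  With the slice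
quantities of `…ConstantShearVariance` (variance `V`, flux `G`, dissipation `D` of the horizontal means of `v₂` at scale
`R`) and the weight `wgt L z = (1 + (z/L)²)⁻¹` (`∫ = πL`, `|wgt'| ≤ wgt/L`), put `Ψ(t) = ∫ V(t,z) wgt_L(z) dz`
(`psi`).  For a profile of the route's Type-I class (rate `C`) on the stratum:

* `hasDerivAt_psi` — `Ψ' = ∫ ∂ₜV wgt` (dominated differentiation: `|∂ₜV| ≤ 4M₀Mₜ` by the time-derivative rate);
* `deriv_psi_le` — `Ψ'(t) ≤ (3M₀(t)/L) Ψ(t) + πL·K(t)/R` (KEY inequality of `…Variance`, one integration by parts in the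
  height against the weight, `|G| ≤ (3/2)M₀V`, `|wgt'| ≤ wgt/L`, and `μ < 1` to drop the dissipation);
* (the Grönwall conclusion and the smallness of the variance at large scales are in the sequel `…ConstantShearDecay`).

WHAT THIS IS NOT: not a claim about Navier–Stokes regularity and not the open residue S2⁗ — one located stratum of a
door route's Type-I Liouville problem (bears_on LADDER-NS N0, rung N0-LocalTubeDoorPoloidal).
-/

noncomputable section

-- the summit and its single sub-problem share the name (CONVENTIONS §1), as in every Theorems file
set_option linter.dupNamespace false

namespace Summit.NavierStokesRegularity.NavierStokesRegularity.Theorems.PoloidalWindowDoorPoloidalWindowRigidityConstantShearGronwall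

open MeasureTheory Set Function Filter Topology Metric InnerProductSpace
open scoped RealInnerProductSpace InnerProductSpace Laplacian ContDiff
open Literature.Analysis Literature.Analysis.FluidPDE
open Summit.NavierStokesRegularity.NavierStokesRegularity.Theorems.PoloidalWindowDoorPoloidalWindowRigidityWindow
open Summit.NavierStokesRegularity.NavierStokesRegularity.Theorems.PoloidalWindowDoorPoloidalWindowRigidityHorizontalMean
open Summit.NavierStokesRegularity.NavierStokesRegularity.Theorems.PoloidalWindowDoorPoloidalWindowRigidityConstantShearMeans
open Summit.NavierStokesRegularity.NavierStokesRegularity.Theorems.PoloidalWindowDoorPoloidalWindowRigidityConstantShearVariance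

/-! ### The weight `(1 + (z/L)²)⁻¹` -/

/-- The Grönwall weight in the height: `wgt L z = (1 + (z/L)²)⁻¹`. -/
def wgt (L z : ℝ) : ℝ := (1 + (z / L) ^ 2)⁻¹

/-- `wgt > 0`. -/
theorem wgt_pos (L z : ℝ) : 0 < wgt L z := by unfold wgt; positivity

/-- `wgt ≤ 1`. -/
theorem wgt_le_one (L z : ℝ) : wgt L z ≤ 1 := by
  unfold wgt; exact inv_le_one_of_one_le₀ (by nlinarith [sq_nonneg (z / L)])

/-- `wgt ≥ 1/2` on `|z| ≤ L`. -/
theorem half_le_wgt {L z : ℝ} (hL : 0 < L) (hz : |z| ≤ L) : 1 / 2 ≤ wgt L z := by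
  unfold wgt
  have h1 : (z / L) ^ 2 ≤ 1 := by
    rw [div_pow, div_le_one (by positivity), ← sq_abs]
    exact pow_le_pow_left₀ (abs_nonneg z) hz 2
  rw [div_eq_inv_mul, mul_one]
  exact inv_anti₀ (by positivity) (by linarith)

/-- `wgt L` is integrable (`L ≠ 0`). -/
theorem integrable_wgt {L : ℝ} (hL : L ≠ 0) : Integrable (wgt L) := by
  have h := integrable_inv_one_add_sq.comp_div hL
  exact h

/-- `∫ wgt L = π L` (`L > 0`). -/
theorem integral_wgt {L : ℝ} (hL : 0 < L) : ∫ z, wgt L z = Real.pi * L := by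
  have h := MeasureTheory.Measure.integral_comp_div (fun x : ℝ => (1 + x ^ 2)⁻¹) L
  simp only [integral_univ_inv_one_add_sq, abs_of_pos hL, smul_eq_mul] at h
  unfold wgt
  rw [h, mul_comm]

/-- The derivative of the weight. -/
theorem hasDerivAt_wgt (L z : ℝ) :
    HasDerivAt (wgt L) (-(2 * (z / L) * L⁻¹) / (1 + (z / L) ^ 2) ^ 2) z := by
  have h1 : HasDerivAt (fun z : ℝ => 1 + (z / L) ^ 2) (2 * (z / L) * L⁻¹) z := by
    have h := ((hasDerivAt_id z).div_const L).pow 2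
    have h' := h.const_add 1
    simpa [pow_one, mul_comm, mul_assoc, mul_left_comm] using h'
  have hne : (1 + (z / L) ^ 2) ≠ 0 := by positivity
  have h2 := h1.inv hne
  exact h2

/-- `|wgt'| ≤ wgt/L` (`L > 0`): `2|z/L| ≤ 1 + (z/L)²`. -/
theorem abs_deriv_wgt_le {L : ℝ} (hL : 0 < L) (z : ℝ) :
    |-(2 * (z / L) * L⁻¹) / (1 + (z / L) ^ 2) ^ 2| ≤ wgt L z / L := by
  have hq : 0 < 1 + (z / L) ^ 2 := by positivity
  have h2 : 2 * |z / L| ≤ 1 + (z / L) ^ 2 := by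
    have := two_mul_le_add_sq |z / L| 1
    rw [sq_abs] at this; linarith
  rw [abs_div, abs_neg, abs_mul, abs_mul, abs_two, abs_inv, abs_of_pos hL, abs_of_pos (pow_pos hq 2), wgt,
    div_le_div_iff₀ (pow_pos hq 2) hL]
  calc 2 * |z / L| * L⁻¹ * L = 2 * |z / L| := by field_simp
    _ ≤ 1 + (z / L) ^ 2 := h2
    _ = (1 + (z / L) ^ 2)⁻¹ * (1 + (z / L) ^ 2) ^ 2 := by field_simp

/-- Continuity of the derivative of the weight. -/
theorem continuous_deriv_wgt (L : ℝ) : Continuous fun z : ℝ => -(2 * (z / L) * L⁻¹) / (1 + (z / L) ^ 2) ^ 2 := by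
  refine Continuous.div (by fun_prop) (by fun_prop) fun z => ?_
  positivity

/-- Continuity of the weight. -/
theorem continuous_wgt (L : ℝ) : Continuous (wgt L) := by
  unfold wgt
  exact Continuous.inv₀ (by fun_prop) fun z => by positivity

/-- A continuous function dominated by a multiple of the weight is integrable. -/
theorem integrable_of_abs_le_mul_wgt {L : ℝ} (hL : L ≠ 0) {f : ℝ → ℝ} (hf : Continuous f) {B : ℝ}
    (h : ∀ z, |f z| ≤ B * wgt L z) : Integrable f :=
  Integrable.mono' ((integrable_wgt hL).const_mul B) hf.aestronglyMeasurable
    (Eventually.of_forall fun z => by rw [Real.norm_eq_abs]; exact h z)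

/-! ### `Ψ(t) = ∫ V wgt` and its derivative -/

variable (φ : ContDiffBump (0 : EuclideanSpace ℝ (Fin 2))) (R : ℝ)
  (v : ℝ → EuclideanSpace ℝ (Fin 3) → EuclideanSpace ℝ (Fin 3))

/-- `Ψ(t) = ∫ V_R(t,z) wgt_L(z) dz`: the weighted total horizontal variance of `v₂`. -/
def psi (L t : ℝ) : ℝ := ∫ z, sliceV φ R v t z * wgt L z

variable {φ R v} {C : ℝ}

section Class

variable (hrate : HasTypeITimeDecay C v) (hcont : ContinuousOn (uncurry v) (Iio (0 : ℝ) ×ˢ univ))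
  (hmild : ∀ s t : ℝ, s < t → t < 0 → ∀ x,
    v t x = UnboundedOperators.heatExtension (v s) (t - s) x - oseenDuhamel 1 s v v t x)
  (hdiv : ∀ t < 0, VectorCalculus.IsDivFree (v t))

include hrate hcont hmild hdiv

/-- `D ≤ 2 (C₁/(−t))²`. -/
theorem sliceD_le {C₁ : ℝ} (hC₁ : ∀ t < 0, ∀ y, ‖fderiv ℝ (v t) y‖ ≤ C₁ / (-t)) {t : ℝ} (ht : t < 0) (z : ℝ) :
    sliceD φ R v t z ≤ 2 * (C₁ / (-t)) ^ 2 := by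
  have hA : IsTypeIAncientMild C v := isTypeIAncientMild_of_class hrate hcont hmild hdiv
  have hud : Differentiable ℝ (v t) := (hA.contDiff_slice ht).differentiable (by simp)
  have hθ := contDiff_vert hrate hcont hmild hdiv ht
  have hc : Continuous fun x => fderiv ℝ (fun y => v t y 2) x (EuclideanSpace.single 0 (1 : ℝ)) ^ 2 +
      fderiv ℝ (fun y => v t y 2) x (EuclideanSpace.single 1 (1 : ℝ)) ^ 2 :=
    (((hθ.continuous_fderiv (by simp)).clm_apply continuous_const).pow 2).add
      (((hθ.continuous_fderiv (by simp)).clm_apply continuous_const).pow 2)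
  have hb : ∀ (b : Fin 3) x, fderiv ℝ (fun y => v t y 2) x (EuclideanSpace.single b (1 : ℝ)) ^ 2 ≤ (C₁ / (-t)) ^ 2 := by
    intro b x
    rw [fderiv_coord_apply (hud x) 2, ← sq_abs]
    exact pow_le_pow_left₀ (abs_nonneg _) (abs_fderiv_single_le (hC₁ t ht) x b 2) 2
  have h := abs_hmean_le φ 0 R z (F := fun x => fderiv ℝ (fun y => v t y 2) x (EuclideanSpace.single 0 (1 : ℝ)) ^ 2 +
      fderiv ℝ (fun y => v t y 2) x (EuclideanSpace.single 1 (1 : ℝ)) ^ 2) hc (M := 2 * (C₁ / (-t)) ^ 2) fun x => by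
    rw [abs_of_nonneg (by positivity)]
    linarith [hb 0 x, hb 1 x]
  exact (le_abs_self _).trans h

/-- `Ψ ≥ 0`. -/
theorem psi_nonneg (L : ℝ) {t : ℝ} (ht : t < 0) : 0 ≤ psi φ R v L t :=
  integral_nonneg fun z => mul_nonneg (sliceV_nonneg hrate hcont hmild hdiv ht z) (wgt_pos L z).le

/-- `Ψ(t) ≤ (C²/(−t)) πL`. -/
theorem psi_le_rate {L : ℝ} (hL : 0 < L) {t : ℝ} (ht : t < 0) : psi φ R v L t ≤ C ^ 2 / (-t) * (Real.pi * L) := by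
  unfold psi
  rw [← integral_wgt hL, ← integral_const_mul]
  refine integral_mono_of_nonneg (Eventually.of_forall fun z => mul_nonneg
      (sliceV_nonneg hrate hcont hmild hdiv ht z) (wgt_pos L z).le) ((integrable_wgt hL.ne').const_mul _)
    (Eventually.of_forall fun z => ?_)
  exact mul_le_mul_of_nonneg_right (sliceV_le hrate hcont hmild hdiv ht z) (wgt_pos L z).le

/-- **`Ψ' = ∫ ∂ₜV wgt`** (dominated differentiation under the integral in the height). -/
theorem hasDerivAt_psi {C₄ : ℝ} (hC₄ : ∀ t < 0, ∀ y, ‖deriv (fun τ => v τ y) t‖ ≤ C₄ / ((-t) * Real.sqrt (-t)))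
    {L : ℝ} (hL : L ≠ 0) {t : ℝ} (ht : t < 0) :
    HasDerivAt (fun τ => psi φ R v L τ) (∫ z, sliceVt φ R v t z * wgt L z) t := by
  have hnt : 0 < -t := neg_pos.2 ht
  -- the time ball `(3t/2, t/2)` and a uniform bound for `∂ₜV` on it
  set δ : ℝ := -t / 2 with hδ
  have hδ0 : 0 < δ := by rw [hδ]; linarith
  have hball : ∀ τ ∈ Metric.ball t δ, τ < 0 ∧ -t / 2 ≤ -τ := by
    intro τ hτ
    rw [Metric.mem_ball, Real.dist_eq, abs_lt] at hτ
    constructor <;> linarith [hτ.1, hτ.2]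
  have hC0 : 0 ≤ C := (isTypeIAncientMild_of_class hrate hcont hmild hdiv).nonneg
  have hC₄0 : 0 ≤ C₄ := by
    have h := (norm_nonneg _).trans (hC₄ t ht 0)
    exact (div_nonneg_iff.1 h).elim (fun h => h.1) fun h => by
      exfalso; linarith [h.2, mul_pos hnt (Real.sqrt_pos.2 hnt)]
  set B : ℝ := 4 * (C / Real.sqrt (-t / 2)) * (C₄ / ((-t / 2) * Real.sqrt (-t / 2))) with hB
  have hbd : ∀ τ ∈ Metric.ball t δ, ∀ z, |sliceVt φ R v τ z| ≤ B := by
    intro τ hτ z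
    obtain ⟨hτ0, hτ1⟩ := hball τ hτ
    refine (abs_sliceVt_le hrate hcont hmild hdiv hC₄ hτ0 z).trans ?_
    have hs : Real.sqrt (-t / 2) ≤ Real.sqrt (-τ) := Real.sqrt_le_sqrt hτ1
    have hs0 : 0 < Real.sqrt (-t / 2) := Real.sqrt_pos.2 (by linarith)
    have h1 : C / Real.sqrt (-τ) ≤ C / Real.sqrt (-t / 2) := div_le_div_of_nonneg_left hC0 hs0 hs
    have h2 : C₄ / ((-τ) * Real.sqrt (-τ)) ≤ C₄ / ((-t / 2) * Real.sqrt (-t / 2)) :=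
      div_le_div_of_nonneg_left hC₄0 (mul_pos (by linarith) hs0) (mul_le_mul hτ1 hs hs0.le (by linarith))
    rw [hB]
    refine mul_le_mul (mul_le_mul_of_nonneg_left h1 (by norm_num)) h2
      (div_nonneg hC₄0 (mul_nonneg (by linarith) (Real.sqrt_nonneg _))) ?_
    exact mul_nonneg (by norm_num) (div_nonneg hC0 (Real.sqrt_nonneg _))
  -- dominated differentiation
  have key := hasDerivAt_integral_of_dominated_loc_of_deriv_le (μ := volume)
    (F := fun τ z => sliceV φ R v τ z * wgt L z) (F' := fun τ z => sliceVt φ R v τ z * wgt L z)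
    (bound := fun z => B * wgt L z) (Metric.ball_mem_nhds t hδ0) ?_ ?_ ?_ ?_ ?_ ?_
  · exact key.2
  · filter_upwards [Metric.ball_mem_nhds t hδ0] with τ hτ
    exact ((continuous_slices hrate hcont hmild hdiv (hball τ hτ).1).1.mul (continuous_wgt L)).aestronglyMeasurable
  · refine integrable_of_abs_le_mul_wgt hL ((continuous_slices hrate hcont hmild hdiv ht).1.mul (continuous_wgt L))
      (B := C ^ 2 / (-t)) fun z => ?_
    rw [abs_mul, abs_of_pos (wgt_pos L z), abs_of_nonneg (sliceV_nonneg hrate hcont hmild hdiv ht z)]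
    exact mul_le_mul_of_nonneg_right (sliceV_le hrate hcont hmild hdiv ht z) (wgt_pos L z).le
  · exact ((continuous_slices hrate hcont hmild hdiv ht).2.1.mul (continuous_wgt L)).aestronglyMeasurable
  · refine Eventually.of_forall fun z τ hτ => ?_
    rw [norm_mul, Real.norm_eq_abs, Real.norm_eq_abs, abs_of_pos (wgt_pos L z)]
    exact mul_le_mul_of_nonneg_right (hbd τ hτ z) (wgt_pos L z).le
  · exact (integrable_wgt hL).const_mul B
  · exact Eventually.of_forall fun z τ hτ => (hasDerivAt_sliceV hrate hcont hmild hdiv (hball τ hτ).1 z).mul_const _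

/-- **`Ψ' ≤ (3M₀/L)Ψ + πL·K(t)/R`** on the stratum (`μ < 1`). -/
theorem deriv_psi_le (hpol : ∀ s < 0, ∀ y, ⟪curl (v s) y, EuclideanSpace.single 2 1⟫_ℝ = 0) {μ : ℝ} (hμ : μ < 1)
    (hslope : ∀ s < 0, ∀ y, ∀ b : Fin 3, b ≠ 2 →
      fderiv ℝ (v s) y (EuclideanSpace.single 2 1) b = μ * fderiv ℝ (v s) y (EuclideanSpace.single b 1) 2)
    {C₁ : ℝ} (hC₁ : ∀ t < 0, ∀ y, ‖fderiv ℝ (v t) y‖ ≤ C₁ / (-t)) (hR : 0 < R) {L : ℝ} (hL : 0 < L)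
    {t : ℝ} (ht : t < 0) :
    ∫ z, sliceVt φ R v t z * wgt L z ≤
      3 * (C / Real.sqrt (-t)) / L * psi φ R v L t +
        R⁻¹ * (8 * (C / Real.sqrt (-t) * (C / Real.sqrt (-t)) * (C / Real.sqrt (-t))) +
          (4 + 2 * |1 - μ|) * (C / Real.sqrt (-t) * (C₁ / (-t)))) * bumpK φ * (Real.pi * L) := by
  obtain ⟨cV, cVt, cG, cGz⟩ := continuous_slices (φ := φ) (R := R) hrate hcont hmild hdiv ht
  set M₀ := C / Real.sqrt (-t) with hM₀
  set Kt := R⁻¹ * (8 * (M₀ * M₀ * M₀) + (4 + 2 * |1 - μ|) * (M₀ * (C₁ / (-t)))) * bumpK φ with hKt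
  have hM₀0 : 0 ≤ M₀ := (norm_nonneg _).trans (hrate t ht 0)
  -- integrability of the pieces against the weight
  have iVt : Integrable fun z => sliceVt φ R v t z * wgt L z := by
    obtain ⟨C₄, hC₄⟩ := Summit.NavierStokesRegularity.NavierStokesRegularity.Theorems.PoloidalWindowDoorPoloidalWindowRigidityConstantShearSlice.exists_timeDeriv_rate_of_class
      hrate hcont hmild
    refine integrable_of_abs_le_mul_wgt hL.ne' (cVt.mul (continuous_wgt L))
      (B := 4 * (C / Real.sqrt (-t)) * (C₄ / ((-t) * Real.sqrt (-t)))) fun z => ?_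
    rw [abs_mul, abs_of_pos (wgt_pos L z)]
    exact mul_le_mul_of_nonneg_right (abs_sliceVt_le hrate hcont hmild hdiv hC₄ ht z) (wgt_pos L z).le
  have iGz : Integrable fun z => sliceGz φ R v t z * wgt L z := by
    refine integrable_of_abs_le_mul_wgt hL.ne' (cGz.mul (continuous_wgt L))
      (B := 6 * (C / Real.sqrt (-t)) ^ 2 * (C₁ / (-t))) fun z => ?_
    rw [abs_mul, abs_of_pos (wgt_pos L z)]
    exact mul_le_mul_of_nonneg_right (abs_sliceGz_le hrate hcont hmild hdiv hC₁ ht z) (wgt_pos L z).le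
  have iD : Integrable fun z => sliceD φ R v t z * wgt L z := by
    have cD : Continuous fun ζ => sliceD φ R v t ζ := by
      have hθ2 : ContDiff ℝ 2 (fun y => v t y 2) := (contDiff_vert hrate hcont hmild hdiv ht).of_le (by norm_cast)
      exact continuous_hmean_height (φ := φ) (R := R) 0
        ((((hθ2.fderiv_right (m := 1) (by norm_cast)).clm_apply contDiff_const).pow 2).add
          (((hθ2.fderiv_right (m := 1) (by norm_cast)).clm_apply contDiff_const).pow 2))
    refine integrable_of_abs_le_mul_wgt hL.ne' (cD.mul (continuous_wgt L)) (B := 2 * (C₁ / (-t)) ^ 2) fun z => ?_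
    rw [abs_mul, abs_of_pos (wgt_pos L z), abs_of_nonneg (sliceD_nonneg t z)]
    exact mul_le_mul_of_nonneg_right (sliceD_le hrate hcont hmild hdiv hC₁ ht z) (wgt_pos L z).le
  have iG : Integrable fun z => sliceG φ R v t z * wgt L z := by
    refine integrable_of_abs_le_mul_wgt hL.ne' (cG.mul (continuous_wgt L)) (B := 3 / 2 * M₀ * (C ^ 2 / (-t))) fun z => ?_
    rw [abs_mul, abs_of_pos (wgt_pos L z)]
    refine mul_le_mul_of_nonneg_right ((abs_sliceG_le hrate hcont hmild hdiv ht z).trans ?_) (wgt_pos L z).le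
    exact mul_le_mul_of_nonneg_left (sliceV_le hrate hcont hmild hdiv ht z) (by positivity)
  have iV : Integrable fun z => sliceV φ R v t z * wgt L z := by
    refine integrable_of_abs_le_mul_wgt hL.ne' (cV.mul (continuous_wgt L)) (B := C ^ 2 / (-t)) fun z => ?_
    rw [abs_mul, abs_of_pos (wgt_pos L z), abs_of_nonneg (sliceV_nonneg hrate hcont hmild hdiv ht z)]
    exact mul_le_mul_of_nonneg_right (sliceV_le hrate hcont hmild hdiv ht z) (wgt_pos L z).le
  -- (1) integrate the KEY inequality against the (positive) weight
  have i12 : Integrable fun z => (-2) * (sliceGz φ R v t z * wgt L z) + (-(2 * (1 - μ))) * (sliceD φ R v t z * wgt L z) :=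
    (iGz.const_mul _).add (iD.const_mul _)
  have iK : Integrable fun z => Kt * wgt L z := (integrable_wgt hL.ne').const_mul _
  have h1 : ∫ z, sliceVt φ R v t z * wgt L z ≤
      ∫ z, ((-2) * (sliceGz φ R v t z * wgt L z) + (-(2 * (1 - μ))) * (sliceD φ R v t z * wgt L z) + Kt * wgt L z) := by
    refine integral_mono iVt (i12.add iK) fun z => ?_
    have hk := key_slice (φ := φ) hrate hcont hmild hdiv hpol hμ.ne hslope hC₁ hR ht z
    have hw := wgt_pos L z
    nlinarith
  rw [integral_add i12 iK, integral_add (iGz.const_mul _) (iD.const_mul _), integral_const_mul, integral_const_mul,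
    integral_const_mul, integral_wgt hL] at h1
  -- (2) the dissipation term is nonpositive
  have h2 : -(2 * (1 - μ)) * ∫ z, sliceD φ R v t z * wgt L z ≤ 0 := by
    have hD : 0 ≤ ∫ z, sliceD φ R v t z * wgt L z :=
      integral_nonneg fun z => mul_nonneg (sliceD_nonneg t z) (wgt_pos L z).le
    nlinarith
  -- (3) one integration by parts in the height: `∫ ∂_zG wgt = −∫ G wgt'`
  have h3 : ∫ z, sliceGz φ R v t z * wgt L z =
      -∫ z, sliceG φ R v t z * (-(2 * (z / L) * L⁻¹) / (1 + (z / L) ^ 2) ^ 2) := by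
    have hG' : ∀ z, fderiv ℝ (fun ζ => sliceG φ R v t ζ) z 1 = sliceGz φ R v t z := fun z => by
      rw [fderiv_apply_one_eq_deriv, (hasDerivAt_sliceG hrate hcont hmild hdiv ht z).deriv]
    have hw' : ∀ z, fderiv ℝ (wgt L) z 1 = -(2 * (z / L) * L⁻¹) / (1 + (z / L) ^ 2) ^ 2 := fun z => by
      rw [fderiv_apply_one_eq_deriv, (hasDerivAt_wgt L z).deriv]
    have hibp := integral_mul_fderiv_eq_neg_fderiv_mul_of_integrable (μ := (volume : Measure ℝ))
      (f := fun ζ => sliceG φ R v t ζ) (g := wgt L) (v := (1 : ℝ)) ?_ ?_ ?_ ?_ ?_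
    · simp only [hG', hw'] at hibp
      rw [hibp, neg_neg]
    · simp only [hG']; exact iGz
    · simp only [hw']
      refine integrable_of_abs_le_mul_wgt hL.ne' (cG.mul (continuous_deriv_wgt L))
        (B := 3 / 2 * M₀ * (C ^ 2 / (-t)) / L) fun z => ?_
      rw [abs_mul]
      calc |sliceG φ R v t z| * |-(2 * (z / L) * L⁻¹) / (1 + (z / L) ^ 2) ^ 2|
          ≤ (3 / 2 * M₀ * sliceV φ R v t z) * (wgt L z / L) :=
            mul_le_mul (abs_sliceG_le hrate hcont hmild hdiv ht z) (abs_deriv_wgt_le hL z) (abs_nonneg _)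
              (by have := sliceV_nonneg (φ := φ) (R := R) hrate hcont hmild hdiv ht z; positivity)
        _ ≤ (3 / 2 * M₀ * (C ^ 2 / (-t))) * (wgt L z / L) :=
            mul_le_mul_of_nonneg_right (mul_le_mul_of_nonneg_left (sliceV_le hrate hcont hmild hdiv ht z)
              (by positivity)) (div_nonneg (wgt_pos L z).le hL.le)
        _ = _ := by ring
    · exact iG
    · exact fun z _ => (hasDerivAt_sliceG hrate hcont hmild hdiv ht z).differentiableAt
    · exact fun z _ => (hasDerivAt_wgt L z).differentiableAt
  -- (4) `|∫ G wgt'| ≤ (3M₀/(2L)) Ψ`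
  have h4 : |∫ z, sliceG φ R v t z * (-(2 * (z / L) * L⁻¹) / (1 + (z / L) ^ 2) ^ 2)| ≤
      3 / 2 * M₀ / L * psi φ R v L t := by
    unfold psi
    rw [← integral_const_mul]
    refine (abs_integral_le_integral_abs).trans (integral_mono_of_nonneg (Eventually.of_forall fun z => abs_nonneg _)
      (iV.const_mul _) (Eventually.of_forall fun z => ?_))
    dsimp only
    rw [abs_mul]
    calc |sliceG φ R v t z| * |-(2 * (z / L) * L⁻¹) / (1 + (z / L) ^ 2) ^ 2|
        ≤ (3 / 2 * M₀ * sliceV φ R v t z) * (wgt L z / L) :=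
          mul_le_mul (abs_sliceG_le hrate hcont hmild hdiv ht z) (abs_deriv_wgt_le hL z) (abs_nonneg _)
            (by have := sliceV_nonneg (φ := φ) (R := R) hrate hcont hmild hdiv ht z; positivity)
      _ = 3 / 2 * M₀ / L * (sliceV φ R v t z * wgt L z) := by ring
  -- assemble
  have h5 : (-2) * ∫ z, sliceGz φ R v t z * wgt L z ≤ 3 * M₀ / L * psi φ R v L t := by
    rw [h3]
    set I := ∫ z, sliceG φ R v t z * (-(2 * (z / L) * L⁻¹) / (1 + (z / L) ^ 2) ^ 2) with hI
    have hI2 := (abs_le.1 h4).2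
    have e1 : (-2 : ℝ) * -I = 2 * I := by ring
    have e2 : 3 * M₀ / L * psi φ R v L t = 2 * (3 / 2 * M₀ / L * psi φ R v L t) := by ring
    rw [e1, e2]
    exact mul_le_mul_of_nonneg_left hI2 zero_le_two
  linarith [h1, h2, h5]

end Class

end Summit.NavierStokesRegularity.NavierStokesRegularity.Theorems.PoloidalWindowDoorPoloidalWindowRigidityConstantShearGronwall

end
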